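import Mathlib
import Literature.MathematicalPhysics.MHD.SolovevFluxSurfaceGGJResistive
import Literature.MathematicalPhysics.MHD.SolovevSafetyFactorMonotone
import Literature.MathematicalPhysics.MHD.PeelingCriterion
import HarnessLib

/-!
# The toroidal peeling criterion (Zheng 2015 §2.5) on the Lee–Cerfon / PCF Solov'ev family: `V″ > 0` on every
# surface, the peeling drive is non-positive, and the criterion `Λ_p < 0` FAILS on every flux surface for every
# value of the free constant (proved, no numerics)

Thirteenth file of the `lcLoop` series (gridfusion-model-5).  gridfusion-lit-3's `PeelingCriterion.lean` (p496287)
types the Lortz–Wesson peeling criterion in GGJ flux-surface form and proves its certification form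
`peelingCriterion_iff_drive : Λ_p < 0 ↔ ⟨σ²B²/G⟩ + p′²⟨1/B²⟩ < (p′V″ + I′Ψ″ − K′Φ″)/V′` and
`not_peelingCriterion_of_drive_nonpos`.  For the record `lcGGJData κ F_B R₀ q₀ a g r` of a surface of the
analytic family (`Ψ″ = 0`, `K′ = 0`, `p′ = −C_s < 0`) this file proves:

* `integral_lcAvgWeightDr_pos` — `∫₀^{2π} ∂w/∂r dt > 0` by the reflection `t ↦ π − t`
  (`cos(π−t) = −cos t`, `u(π−t) = 2R₀² − u(t)`; the pair `∂w/∂r(t) + ∂w/∂r(π−t)` is `≥ 0`, and `> 0` on `(0, π/2)`)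
  and `t ↦ 2π − t`; hence `lcGGJData_V''_pos : V″ > 0` (the volume within the surface is a strictly CONVEX
  function of the flux label) — the analogue of gridfusion-sos-6's `integral_lcQKernelDr_pos` (p491122);
* `lcGGJData_Φ''_pos : Φ″ > 0` for `g > 0` (from `integral_lcQKernelDr_pos`), so the shear `Λ = −2πΦ″ ≠ 0`;
* `lcGGJData_drive_nonpos` — the printed drive `(p′V″ + I′Ψ″ − K′Φ″)/V′ = −C_sV″/V′ ≤ 0`;
* `not_peelingCriterion_lcGGJData` — **`¬ Λ_p < 0` on EVERY surface `0 < r < R₀/2`, for EVERY `g > 0`**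
  (lit-3's `not_peelingCriterion_of_drive_nonpos` with its five hypotheses discharged: `Λ ≠ 0`, `V′ ≠ 0`,
  `⟨B²/G⟩ > 0`, `⟨σ²B²/(B²G)⟩ ≥ 0`, `⟨1/B²⟩ ≥ 0`), and the g-free identity
  `lcGGJData_peelingLHS` : `⟨σ²B²/G⟩ + p′²⟨1/B²⟩ = C_s²·∫u·w/G ÷ ∫w` (the factors `g² + G` cancel).

HONEST FRAMING (three columns): CERTIFIED (kernel, here) = the printed criterion FAILS on the model's
surfaces — a NEGATIVE criterion row about MODEL M (analytic fixed-boundary Solov'ev equilibrium with finite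
edge current density and pressure gradient), criterion as printed (ideal localized external/peeling modes,
vacuum term dropped at O(ε²), no wall, no separatrix); VALIDATED margins (how strongly it fails) are the numbers in
bench/F1DR-validated-lineageB.json; nothing about a device. Typer/prover: gridfusion-model-5 (g4), 2026-08-27.
-/

noncomputable section

namespace Literature.MathematicalPhysics.MHD.Solovev

open GradShafranov FluxGeometry Mercier.FluxForm _root_.Real MeasureTheory intervalIntegral _root_.Set

/-! ## §1 `∫₀^{2π} ∂w/∂r dt > 0` (reflection) -/

/-- `x ↦ (x√x)⁻¹` is antitone on `(0, ∞)`. [folklore] -/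
private theorem inv32_antitone {x y : ℝ} (hx : 0 < x) (hxy : x ≤ y) :
    (y * Real.sqrt y)⁻¹ ≤ (x * Real.sqrt x)⁻¹ := by
  have hy : 0 < y := lt_of_lt_of_le hx hxy
  apply inv_anti₀ (mul_pos hx (Real.sqrt_pos.2 hx))
  exact mul_le_mul hxy (Real.sqrt_le_sqrt hxy) (Real.sqrt_nonneg _) hy.le

/-- `x ↦ (x√x)⁻¹` is strictly antitone on `(0, ∞)`. [folklore] -/
private theorem inv32_strictAnti {x y : ℝ} (hx : 0 < x) (hxy : x < y) :
    (y * Real.sqrt y)⁻¹ < (x * Real.sqrt x)⁻¹ := by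
  have hy : 0 < y := lt_trans hx hxy
  apply inv_strictAnti₀ (mul_pos hx (Real.sqrt_pos.2 hx))
  exact mul_lt_mul hxy (Real.sqrt_le_sqrt hxy.le) (Real.sqrt_pos.2 hx) hy.le

/-- The reflected pair `∂w/∂r(t) + ∂w/∂r(π − t) = (κR₀cos t/(2c))·((u(π−t)√u(π−t))⁻¹ − (u√u)⁻¹)`.
[cite: LeeCerfon2015, §4.1 (boundary parametrisation)] -/
theorem lcAvgWeightDr_pair (κ FB R₀ q₀ r t : ℝ) :
    lcAvgWeightDr κ FB R₀ q₀ r t + lcAvgWeightDr κ FB R₀ q₀ r (π - t)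
      = κ * (R₀ * Real.cos t) / (2 * (κ * FB / (2 * R₀ ^ 3 * q₀)))
          * ((lcU R₀ r (π - t) * Real.sqrt (lcU R₀ r (π - t)))⁻¹ - (lcU R₀ r t * Real.sqrt (lcU R₀ r t))⁻¹) := by
  unfold lcAvgWeightDr
  rw [Real.cos_pi_sub]
  ring

/-- The reflected pair is nonnegative on every regular surface (`κ, F_B, q₀, R₀ > 0`, `0 ≤ r`, `2r < R₀`).
[cite: LeeCerfon2015, §4.1 (boundary parametrisation)] -/
theorem lcAvgWeightDr_pair_nonneg {R₀ κ FB q₀ r : ℝ} (hR₀ : 0 < R₀) (hκ : 0 < κ) (hFB : 0 < FB)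
    (hq₀ : 0 < q₀) (hr : 0 ≤ r) (h2r : 2 * r < R₀) (t : ℝ) :
    0 ≤ lcAvgWeightDr κ FB R₀ q₀ r t + lcAvgWeightDr κ FB R₀ q₀ r (π - t) := by
  rw [lcAvgWeightDr_pair]
  have hu := lcU_pos hR₀ hr h2r t
  have hu' := lcU_pos hR₀ hr h2r (π - t)
  have hdiff : lcU R₀ r t - lcU R₀ r (π - t) = 4 * r * R₀ * Real.cos t := by
    rw [lcU_pi_sub]; unfold lcU; ring
  have hc0 : 0 < κ * FB / (2 * R₀ ^ 3 * q₀) := by positivity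
  rcases le_or_gt 0 (Real.cos t) with hc | hc
  · have hle : lcU R₀ r (π - t) ≤ lcU R₀ r t := by nlinarith [mul_nonneg (mul_nonneg hr hR₀.le) hc]
    exact mul_nonneg (by positivity) (sub_nonneg.2 (inv32_antitone hu' hle))
  · have hle : lcU R₀ r t ≤ lcU R₀ r (π - t) := by
      nlinarith [mul_nonneg (mul_nonneg hr hR₀.le) (neg_nonneg.2 hc.le)]
    apply mul_nonneg_of_nonpos_of_nonpos
    · apply div_nonpos_of_nonpos_of_nonneg _ (by positivity)
      have : κ * (R₀ * Real.cos t) = (κ * R₀) * Real.cos t := by ring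
      rw [this]
      exact mul_nonpos_of_nonneg_of_nonpos (by positivity) hc.le
    · exact sub_nonpos.2 (inv32_antitone hu hle)

/-- On `(0, π/2)` the reflected pair is strictly positive when `r > 0`. [cite: LeeCerfon2015, §4.1 (boundary parametrisation)] -/
theorem lcAvgWeightDr_pair_pos {R₀ κ FB q₀ r : ℝ} (hR₀ : 0 < R₀) (hκ : 0 < κ) (hFB : 0 < FB)
    (hq₀ : 0 < q₀) (hr : 0 < r) (h2r : 2 * r < R₀) {t : ℝ} (ht : t ∈ Ioo 0 (π / 2)) :
    0 < lcAvgWeightDr κ FB R₀ q₀ r t + lcAvgWeightDr κ FB R₀ q₀ r (π - t) := by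
  rw [lcAvgWeightDr_pair]
  have hu' := lcU_pos hR₀ hr.le h2r (π - t)
  have hc : 0 < Real.cos t := Real.cos_pos_of_mem_Ioo ⟨by linarith [ht.1, Real.pi_pos], ht.2⟩
  have hdiff : lcU R₀ r t - lcU R₀ r (π - t) = 4 * r * R₀ * Real.cos t := by
    rw [lcU_pi_sub]; unfold lcU; ring
  have hlt : lcU R₀ r (π - t) < lcU R₀ r t := by nlinarith [mul_pos (mul_pos hr hR₀) hc]
  have hc0 : 0 < κ * FB / (2 * R₀ ^ 3 * q₀) := by positivity
  exact mul_pos (by positivity) (sub_pos.2 (inv32_strictAnti hu' hlt))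

/-- Continuity of `∂w/∂r` in `t` on a regular surface. [cite: LeeCerfon2015, §4.1 (boundary parametrisation)] -/
theorem continuous_lcAvgWeightDr {R₀ κ FB q₀ r : ℝ} (hR₀ : 0 < R₀) (hκ : 0 < κ) (hFB : 0 < FB)
    (hq₀ : 0 < q₀) (hr : 0 ≤ r) (h2r : 2 * r < R₀) : Continuous (lcAvgWeightDr κ FB R₀ q₀ r) := by
  have hc : Continuous (lcU R₀ r) := by unfold lcU; fun_prop
  have e : lcAvgWeightDr κ FB R₀ q₀ r = fun t => -(κ * (R₀ * Real.cos t))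
      / (2 * (κ * FB / (2 * R₀ ^ 3 * q₀)) * (lcU R₀ r t * Real.sqrt (lcU R₀ r t))) := by funext t; rfl
  rw [e]
  have h1 : Continuous fun t => -(κ * (R₀ * Real.cos t)) := by fun_prop
  have h2 : Continuous fun t => 2 * (κ * FB / (2 * R₀ ^ 3 * q₀)) * (lcU R₀ r t * Real.sqrt (lcU R₀ r t)) :=
    continuous_const.mul (hc.mul hc.sqrt)
  have hc0 : 0 < κ * FB / (2 * R₀ ^ 3 * q₀) := by positivity
  exact h1.div₀ h2 fun t =>
    (mul_pos (by positivity) (mul_pos (lcU_pos hR₀ hr h2r t) (Real.sqrt_pos.2 (lcU_pos hR₀ hr h2r t)))).ne'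

/-- `∫₀^π ∂w/∂r dt > 0` (half the integral of the nonnegative reflected pair, positive on `(0, π/2)`).
[cite: LeeCerfon2015, §4.1 (boundary parametrisation)] -/
theorem integral_lcAvgWeightDr_half_pos {R₀ κ FB q₀ r : ℝ} (hR₀ : 0 < R₀) (hκ : 0 < κ) (hFB : 0 < FB)
    (hq₀ : 0 < q₀) (hr : 0 < r) (h2r : 2 * r < R₀) :
    0 < ∫ t in (0 : ℝ)..π, lcAvgWeightDr κ FB R₀ q₀ r t := by
  have hc := continuous_lcAvgWeightDr hR₀ hκ hFB hq₀ hr.le h2r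
  have hc' : Continuous fun t => lcAvgWeightDr κ FB R₀ q₀ r (π - t) :=
    hc.comp (continuous_const.sub continuous_id)
  have hrefl : ∫ t in (0 : ℝ)..π, lcAvgWeightDr κ FB R₀ q₀ r (π - t)
      = ∫ t in (0 : ℝ)..π, lcAvgWeightDr κ FB R₀ q₀ r t := by
    rw [intervalIntegral.integral_comp_sub_left (fun t => lcAvgWeightDr κ FB R₀ q₀ r t) π, sub_self, sub_zero]
  have hsum : ∫ t in (0 : ℝ)..π, (lcAvgWeightDr κ FB R₀ q₀ r t + lcAvgWeightDr κ FB R₀ q₀ r (π - t))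
      = 2 * ∫ t in (0 : ℝ)..π, lcAvgWeightDr κ FB R₀ q₀ r t := by
    rw [intervalIntegral.integral_add (hc.intervalIntegrable _ _) (hc'.intervalIntegrable _ _), hrefl]
    ring
  have hlt : ∫ t in (0 : ℝ)..π, (0 : ℝ)
      < ∫ t in (0 : ℝ)..π, (lcAvgWeightDr κ FB R₀ q₀ r t + lcAvgWeightDr κ FB R₀ q₀ r (π - t)) := by
    refine intervalIntegral.integral_lt_integral_of_continuousOn_of_le_of_exists_lt Real.pi_pos
      continuousOn_const ((hc.add hc').continuousOn)
      (fun t _ => lcAvgWeightDr_pair_nonneg hR₀ hκ hFB hq₀ hr.le h2r t)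
      ⟨π / 4, ⟨by positivity, by linarith [Real.pi_pos]⟩,
        lcAvgWeightDr_pair_pos hR₀ hκ hFB hq₀ hr h2r ⟨by positivity, by linarith [Real.pi_pos]⟩⟩
  rw [intervalIntegral.integral_const, hsum] at hlt
  simp only [smul_zero] at hlt
  linarith

/-- **`∫₀^{2π} ∂w/∂r dt > 0`** on every surface `0 < r < R₀/2` (the second half `[π, 2π]` is the first by
`t ↦ 2π − t`). [cite: LeeCerfon2015, §4.1 (boundary parametrisation)] -/
theorem integral_lcAvgWeightDr_pos {R₀ κ FB q₀ r : ℝ} (hR₀ : 0 < R₀) (hκ : 0 < κ) (hFB : 0 < FB)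
    (hq₀ : 0 < q₀) (hr : 0 < r) (h2r : 2 * r < R₀) :
    0 < ∫ t in (0 : ℝ)..(2 * π), lcAvgWeightDr κ FB R₀ q₀ r t := by
  have hc := continuous_lcAvgWeightDr hR₀ hκ hFB hq₀ hr.le h2r
  have hsplit : ∫ t in (0 : ℝ)..(2 * π), lcAvgWeightDr κ FB R₀ q₀ r t
      = (∫ t in (0 : ℝ)..π, lcAvgWeightDr κ FB R₀ q₀ r t)
        + ∫ t in π..(2 * π), lcAvgWeightDr κ FB R₀ q₀ r t :=
    (intervalIntegral.integral_add_adjacent_intervals (hc.intervalIntegrable _ _) (hc.intervalIntegrable _ _)).symm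
  have hper : ∀ t, lcAvgWeightDr κ FB R₀ q₀ r (2 * π - t) = lcAvgWeightDr κ FB R₀ q₀ r t := fun t => by
    unfold lcAvgWeightDr lcU
    rw [Real.cos_two_pi_sub]
  have hsecond : ∫ t in π..(2 * π), lcAvgWeightDr κ FB R₀ q₀ r t
      = ∫ t in (0 : ℝ)..π, lcAvgWeightDr κ FB R₀ q₀ r t := by
    have h := intervalIntegral.integral_comp_sub_left (fun t => lcAvgWeightDr κ FB R₀ q₀ r t) (2 * π)
      (a := 0) (b := π)
    simp only [hper] at h
    rw [show 2 * π - π = π by ring, sub_zero] at h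
    exact h.symm
  rw [hsplit, hsecond]
  have := integral_lcAvgWeightDr_half_pos hR₀ hκ hFB hq₀ hr h2r
  linarith

/-! ## §2 Signs of the record's `V″`, `Φ″`, drive -/

section signs

variable {R₀ κ FB q₀ r : ℝ} (hR₀ : 0 < R₀) (hκ : 0 < κ) (hFB : 0 < FB) (hq₀ : 0 < q₀)
  (hr : 0 < r) (h2r : 2 * r < R₀)
include hR₀ hκ hFB hq₀ hr h2r

/-- **`V″ > 0` on every surface** (the volume is strictly convex in the flux label). [cite: Jardin2010, §5.3 eq. (5.29)] -/
theorem lcGGJData_V''_pos (a g : ℝ) : 0 < (lcGGJData κ FB R₀ q₀ a g r).V'' := by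
  rw [lcGGJData_V'' hR₀ hκ hFB hq₀ hr h2r]
  have h1 := integral_lcAvgWeightDr_pos hR₀ hκ hFB hq₀ hr h2r
  have hc0 : 0 < κ * FB / (2 * R₀ ^ 3 * q₀) := by positivity
  positivity

/-- **`Φ″ > 0` on every surface** for `g > 0` (positive shear; sos-6's `integral_lcQKernelDr_pos`).
[cite: Jardin2010, §5.3 eq. (5.31)] -/
theorem lcGGJData_Φ''_pos {g : ℝ} (hg : 0 < g) (a : ℝ) : 0 < (lcGGJData κ FB R₀ q₀ a g r).Φ'' := by
  rw [lcGGJData_Φ'' hR₀ hκ hFB hq₀ hr h2r]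
  have h1 := integral_lcQKernelDr_pos hR₀ hr h2r
  have hc0 : 0 < κ * FB / (2 * R₀ ^ 3 * q₀) := by positivity
  positivity

/-- Hence the shear combination `Λ = −2πΦ″` is nonzero (`g > 0`). [cite: Jardin2010, §8.5.4 eq. (8.134)] -/
theorem lcGGJData_shear_ne {g : ℝ} (hg : 0 < g) (a : ℝ) : (lcGGJData κ FB R₀ q₀ a g r).shear ≠ 0 := by
  rw [lcGGJData_shear]
  have := lcGGJData_Φ''_pos hR₀ hκ hFB hq₀ hr h2r hg a
  have hπ := Real.pi_pos
  nlinarith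

omit hr h2r in
/-- `C_s > 0` for the family (`κ, F_B, R₀, q₀ > 0`). [cite: LeeCerfon2015, §4.1 eq. (solo2)] -/
theorem csLC_pos' : 0 < csLC κ FB R₀ q₀ := by
  unfold csLC; positivity

/-- **The printed peeling drive is non-positive:** `(p′V″ + I′Ψ″ − K′Φ″)/V′ = −C_sV″/V′ ≤ 0` (indeed `< 0`).
[cite: Zheng2015, §2.5 eqs. (2.100)–(2.101)] -/
theorem lcGGJData_drive_nonpos (a g : ℝ) :
    ((lcGGJData κ FB R₀ q₀ a g r).p' * (lcGGJData κ FB R₀ q₀ a g r).V''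
        + (lcGGJData κ FB R₀ q₀ a g r).I' * (lcGGJData κ FB R₀ q₀ a g r).Ψ''
        - (lcGGJData κ FB R₀ q₀ a g r).K' * (lcGGJData κ FB R₀ q₀ a g r).Φ'')
      / (lcGGJData κ FB R₀ q₀ a g r).V' ≤ 0 := by
  have hV := volumeDerivE_lcLoop_pos hR₀ hκ hFB hq₀ hr h2r a
  have hV2 := lcGGJData_V''_pos hR₀ hκ hFB hq₀ hr h2r a g
  have hC := csLC_pos' hR₀ hκ hFB hq₀
  have hp : (lcGGJData κ FB R₀ q₀ a g r).p' = -csLC κ FB R₀ q₀ := rfl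
  have hΨ : (lcGGJData κ FB R₀ q₀ a g r).Ψ'' = 0 := rfl
  have hK : (lcGGJData κ FB R₀ q₀ a g r).K' = 0 := rfl
  have hV' : (lcGGJData κ FB R₀ q₀ a g r).V' = volumeDerivE (psiLC κ FB R₀ q₀ a) (lcLoop R₀ κ r) (2 * π) := rfl
  rw [hp, hΨ, hK, hV']
  apply div_nonpos_of_nonpos_of_nonneg _ hV.le
  nlinarith

/-- The g-free identity behind the left side: `⟨σ²B²/G⟩ + p′²⟨1/B²⟩ = C_s²·∫u·w/G ÷ ∫w` (the factors `g² + G`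
cancel). [cite: Zheng2015, §2.5 eqs. (2.100)–(2.101)] -/
theorem lcGGJData_peelingLHS (a g : ℝ) :
    (lcGGJData κ FB R₀ q₀ a g r).gσ2B2 + (lcGGJData κ FB R₀ q₀ a g r).p' ^ 2 * (lcGGJData κ FB R₀ q₀ a g r).invB2
      = csLC κ FB R₀ q₀ ^ 2 * ((∫ t in (0 : ℝ)..(2 * π),
          lcU R₀ r t * lcAvgWeight κ FB R₀ q₀ r t / lcGradSq κ FB R₀ q₀ r t)
          / ∫ t in (0 : ℝ)..(2 * π), lcAvgWeight κ FB R₀ q₀ r t) := by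
  have hp : (lcGGJData κ FB R₀ q₀ a g r).p' = -csLC κ FB R₀ q₀ := rfl
  rw [lcGGJData_gσ2B2 hR₀ hκ hFB hq₀ hr h2r, lcGGJData_invB2 hR₀ hκ hFB hq₀ hr h2r, hp]
  have hcU : Continuous (fun t => lcU R₀ r t) := by unfold lcU; fun_prop
  have hcW := continuous_lcAvgWeight hR₀ hκ hFB hq₀ hr.le h2r
  have hcG : Continuous (fun t => lcGradSq κ FB R₀ q₀ r t) := by
    rw [continuous_iff_continuousAt]; intro t
    have hu := lcU_pos hR₀ hr.le h2r t
    unfold lcGradSq; fun_prop (disch := positivity)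
  have hposU : ∀ t, 0 < lcU R₀ r t := lcU_pos hR₀ hr.le h2r
  have hposG : ∀ t, 0 < lcGradSq κ FB R₀ q₀ r t := lcGradSq_pos hR₀ hκ hFB hq₀ hr h2r
  have hden : ∀ t, 0 < g ^ 2 + lcGradSq κ FB R₀ q₀ r t := fun t => by have := hposG t; positivity
  have h1 : Continuous fun t => lcU R₀ r t / ((g ^ 2 + lcGradSq κ FB R₀ q₀ r t) * lcGradSq κ FB R₀ q₀ r t)
      * lcAvgWeight κ FB R₀ q₀ r t :=
    (hcU.div ((continuous_const.add hcG).mul hcG) fun t => (mul_pos (hden t) (hposG t)).ne').mul hcW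
  have h2 : Continuous fun t => lcU R₀ r t / (g ^ 2 + lcGradSq κ FB R₀ q₀ r t) * lcAvgWeight κ FB R₀ q₀ r t :=
    (hcU.div (continuous_const.add hcG) fun t => (hden t).ne').mul hcW
  have hsum : g ^ 2 * (∫ t in (0 : ℝ)..(2 * π), lcU R₀ r t
        / ((g ^ 2 + lcGradSq κ FB R₀ q₀ r t) * lcGradSq κ FB R₀ q₀ r t) * lcAvgWeight κ FB R₀ q₀ r t)
      + (∫ t in (0 : ℝ)..(2 * π), lcU R₀ r t / (g ^ 2 + lcGradSq κ FB R₀ q₀ r t) * lcAvgWeight κ FB R₀ q₀ r t)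
      = ∫ t in (0 : ℝ)..(2 * π), lcU R₀ r t * lcAvgWeight κ FB R₀ q₀ r t / lcGradSq κ FB R₀ q₀ r t := by
    rw [← intervalIntegral.integral_const_mul, ← intervalIntegral.integral_add
      ((h1.const_mul _).intervalIntegrable _ _) (h2.intervalIntegrable _ _)]
    refine intervalIntegral.integral_congr fun t _ => ?_
    have hG := hposG t
    have hd := hden t
    field_simp
  rw [← hsum]
  ring

/-- **THE PEELING CRITERION FAILS on every surface of the family**, for every `g > 0`: `¬ Λ_p < 0` for
`lcGGJData κ F_B R₀ q₀ a g r` (`0 < r < R₀/2`).  lit-3's `not_peelingCriterion_of_drive_nonpos` with its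
hypotheses discharged: `Λ ≠ 0` (positive shear), `V′ ≠ 0`, `⟨B²/G⟩ > 0`, `⟨σ²B²/(B²G)⟩ ≥ 0`, `⟨1/B²⟩ ≥ 0`, drive
`−C_sV″/V′ ≤ 0`. [cite: Zheng2015, §2.5 eqs. (2.100)–(2.101)] -/
theorem not_peelingCriterion_lcGGJData {g : ℝ} (hg : 0 < g) (a : ℝ) :
    ¬ (lcGGJData κ FB R₀ q₀ a g r).PeelingCriterion := by
  have hΛ := lcGGJData_shear_ne hR₀ hκ hFB hq₀ hr h2r hg a
  have hV := lcGGJData_V'_ne hR₀ hκ hFB hq₀ hr h2r (a := a) (g := g)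
  have hgB := lcGGJData_gB2_pos hR₀ hκ hFB hq₀ hr h2r a g
  have hW := integral_lcAvgWeight_pos hR₀ hκ hFB hq₀ hr.le h2r
  obtain ⟨-, -, -, h4, h5⟩ := integral_ggjBlocks_pos hR₀ hκ hFB hq₀ hr h2r g
  have hσ2 : 0 ≤ (lcGGJData κ FB R₀ q₀ a g r).gσ2B2 := by
    rw [lcGGJData_gσ2B2 hR₀ hκ hFB hq₀ hr h2r]
    exact mul_nonneg (sq_nonneg _) (div_nonneg h5.le hW.le)
  have hinv : 0 ≤ (lcGGJData κ FB R₀ q₀ a g r).invB2 := by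
    rw [lcGGJData_invB2 hR₀ hκ hFB hq₀ hr h2r]
    exact div_nonneg h4.le hW.le
  exact SurfaceData.not_peelingCriterion_of_drive_nonpos _ hΛ hV hgB hσ2 hinv
    (lcGGJData_drive_nonpos hR₀ hκ hFB hq₀ hr h2r a g)

end signs

end Literature.MathematicalPhysics.MHD.Solovev
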